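import Summits.Ventures.PercRepro.C041CycleStatus

/-!
# ROW C-041 — THE STATUSES OF A COLOURING OF THE CYCLE WITH THREE EXITS, BY ITS FOUR ARCS (p6, gen 31; groundwork
for the dictionary with mine-3's three-exit arc-type model `thetaSq`, C-041.md §21 (ah))

The cycle `cyc n` with the anchor `0` and the exits `i < j < k` (all `≠ 0`) splits into the arcs `A₁ = [0, i)`,
`A₂ = [i, j)`, `A₃ = [j, k)`, `A₄ = [k, n]`.  By the reach lemma of `C041CycleHost` every status of a colouring —
merged / reached for each exit, and the blue connection of each pair of exits — is read off the arcs
(`Mg_cyc3_exit₁` … `Mg_cyc3_exits₁₃`): a vertex is reached from another along a colour iff one of the two arcs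
between them is entirely of that colour, and those arcs are unions of the `A`'s.  This is mine-3's status table for
`sqCol` (the 81 cases); the counts over the colourings are `C041CycleCount3`, the dictionary `C041CycleDict3`.
-/

namespace PercRepro

namespace ZoneZ

namespace TwoExit

open ZoneData Pendant

variable (n : ℕ) (i j k : Fin (n + 1)) (c : Bool) (ω : Fin (n + 1) → Bool)

/-- The third arc `[j, k)` of the cycle with three exits. -/
def arc₃' (x : Fin (n + 1)) : Prop := j.val ≤ x.val ∧ x.val < k.val

/-- The last arc `[k, n]` of the cycle with three exits. -/
def arc₄ (x : Fin (n + 1)) : Prop := k.val ≤ x.val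

/-- `[i, n]` is the union of the last three arcs. -/
theorem allc_ge_iff₃ (hij : i.val ≤ j.val) (hjk : j.val ≤ k.val) :
    (∀ x : Fin (n + 1), i.val ≤ x.val → ω x = c) ↔
      allc n (arc₂ n i j) c ω ∧ allc n (arc₃' n j k) c ω ∧ allc n (arc₄ n k) c ω := by
  unfold allc arc₂ arc₃' arc₄
  constructor
  · intro h
    exact ⟨fun x hx => h x hx.1, fun x hx => h x (by omega), fun x hx => h x (by omega)⟩
  · rintro ⟨h2, h3, h4⟩ x hx
    by_cases hxj : x.val < j.val
    · exact h2 x ⟨hx, hxj⟩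
    · by_cases hxk : x.val < k.val
      · exact h3 x ⟨by omega, hxk⟩
      · exact h4 x (by omega)

/-- `[j, n]` is the union of the last two arcs. -/
theorem allc_ge_iff₄ (hjk : j.val ≤ k.val) :
    (∀ x : Fin (n + 1), j.val ≤ x.val → ω x = c) ↔ allc n (arc₃' n j k) c ω ∧ allc n (arc₄ n k) c ω := by
  unfold allc arc₃' arc₄
  constructor
  · intro h
    exact ⟨fun x hx => h x hx.1, fun x hx => h x (by omega)⟩
  · rintro ⟨h3, h4⟩ x hx
    by_cases hxk : x.val < k.val
    · exact h3 x ⟨hx, hxk⟩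
    · exact h4 x (by omega)

/-- `[0, j)` is the union of the first two arcs. -/
theorem allc_lt_iff₂ (hij : i.val ≤ j.val) :
    (∀ x : Fin (n + 1), x.val < j.val → ω x = c) ↔ allc n (arc₁ n i) c ω ∧ allc n (arc₂ n i j) c ω :=
  allc_lt_iff n i j c ω hij

/-- `[0, k)` is the union of the first three arcs. -/
theorem allc_lt_iff₃ (hij : i.val ≤ j.val) (hjk : j.val ≤ k.val) :
    (∀ x : Fin (n + 1), x.val < k.val → ω x = c) ↔
      allc n (arc₁ n i) c ω ∧ allc n (arc₂ n i j) c ω ∧ allc n (arc₃' n j k) c ω := by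
  unfold allc arc₁ arc₂ arc₃'
  constructor
  · intro h
    exact ⟨fun x hx => h x (by omega), fun x hx => h x (by omega), fun x hx => h x hx.2⟩
  · rintro ⟨h1, h2, h3⟩ x hx
    by_cases hxi : x.val < i.val
    · exact h1 x hxi
    · by_cases hxj : x.val < j.val
      · exact h2 x ⟨by omega, hxj⟩
      · exact h3 x ⟨by omega, hx⟩

/-- The complement of `[i, j)` is the union of the other three arcs. -/
theorem allc_outer_iff₂ (hjk : j.val ≤ k.val) :
    (∀ x : Fin (n + 1), x.val < i.val ∨ j.val ≤ x.val → ω x = c) ↔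
      allc n (arc₁ n i) c ω ∧ allc n (arc₃' n j k) c ω ∧ allc n (arc₄ n k) c ω := by
  unfold allc arc₁ arc₃' arc₄
  constructor
  · intro h
    exact ⟨fun x hx => h x (Or.inl hx), fun x hx => h x (Or.inr hx.1), fun x hx => h x (Or.inr (by omega))⟩
  · rintro ⟨h1, h3, h4⟩ x hx
    rcases hx with hx | hx
    · exact h1 x hx
    · by_cases hxk : x.val < k.val
      · exact h3 x ⟨hx, hxk⟩
      · exact h4 x (by omega)

/-- The complement of `[j, k)` is the union of the other three arcs. -/
theorem allc_outer_iff₃ (hij : i.val ≤ j.val) :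
    (∀ x : Fin (n + 1), x.val < j.val ∨ k.val ≤ x.val → ω x = c) ↔
      allc n (arc₁ n i) c ω ∧ allc n (arc₂ n i j) c ω ∧ allc n (arc₄ n k) c ω := by
  unfold allc arc₁ arc₂ arc₄
  constructor
  · intro h
    exact ⟨fun x hx => h x (Or.inl (by omega)), fun x hx => h x (Or.inl hx.2), fun x hx => h x (Or.inr hx)⟩
  · rintro ⟨h1, h2, h4⟩ x hx
    rcases hx with hx | hx
    · by_cases hxi : x.val < i.val
      · exact h1 x hxi
      · exact h2 x ⟨by omega, hx⟩
    · exact h4 x hx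

/-- `[i, k)` is the union of the two middle arcs; its complement the union of the outer two. -/
theorem allc_mid_iff (hij : i.val ≤ j.val) (hjk : j.val ≤ k.val) :
    (∀ x : Fin (n + 1), i.val ≤ x.val ∧ x.val < k.val → ω x = c) ↔
      allc n (arc₂ n i j) c ω ∧ allc n (arc₃' n j k) c ω := by
  unfold allc arc₂ arc₃'
  constructor
  · intro h
    exact ⟨fun x hx => h x ⟨hx.1, by omega⟩, fun x hx => h x ⟨by omega, hx.2⟩⟩
  · rintro ⟨h2, h3⟩ x hx
    by_cases hxj : x.val < j.val
    · exact h2 x ⟨hx.1, hxj⟩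
    · exact h3 x ⟨by omega, hx.2⟩

/-- The complement of `[i, k)` is the union of the outer arcs. -/
theorem allc_outer_iff₁₃ :
    (∀ x : Fin (n + 1), x.val < i.val ∨ k.val ≤ x.val → ω x = c) ↔
      allc n (arc₁ n i) c ω ∧ allc n (arc₄ n k) c ω := by
  unfold allc arc₁ arc₄
  constructor
  · intro h
    exact ⟨fun x hx => h x (Or.inl hx), fun x hx => h x (Or.inr hx)⟩
  · rintro ⟨h1, h4⟩ x hx
    rcases hx with hx | hx
    · exact h1 x hx
    · exact h4 x hx

/-- A pair of vertices `x ≤ z` of the cycle: reached iff `[x, z)` or its complement is monochromatic. -/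
theorem mem_reach_cyc_le (x z : Fin (n + 1)) (hxz : x.val ≤ z.val) :
    z ∈ reach (cAdj (cyc n) c ω) {x} ↔
      (∀ y : Fin (n + 1), x.val ≤ y.val ∧ y.val < z.val → ω y = c) ∨
        (∀ y : Fin (n + 1), y.val < x.val ∨ z.val ≤ y.val → ω y = c) := by
  rw [mem_reach_cyc]
  unfold fwdArc bwdArc
  simp only [if_pos hxz]

/-- **`x_i` is merged** iff `A₁` is blue or `A₂`, `A₃`, `A₄` are. -/
theorem Mg_cyc3_exit₁ (hij : i.val ≤ j.val) (hjk : j.val ≤ k.val) :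
    (cyc n).Mg 0 i ω ↔ allc n (arc₁ n i) false ω ∨
      (allc n (arc₂ n i j) false ω ∧ allc n (arc₃' n j k) false ω ∧ allc n (arc₄ n k) false ω) := by
  unfold Mg
  rw [← Pendant.cAdj_false, mem_reach_cyc_zero, allc_ge_iff₃ n i j k false ω hij hjk]
  rfl

/-- **`x_i` is reached** iff `A₁` is red or `A₂`, `A₃`, `A₄` are. -/
theorem Rd_cyc3_exit₁ (hij : i.val ≤ j.val) (hjk : j.val ≤ k.val) :
    (cyc n).Rd 0 i ω ↔ allc n (arc₁ n i) true ω ∨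
      (allc n (arc₂ n i j) true ω ∧ allc n (arc₃' n j k) true ω ∧ allc n (arc₄ n k) true ω) := by
  unfold Rd
  rw [← Pendant.cAdj_true, mem_reach_cyc_zero, allc_ge_iff₃ n i j k true ω hij hjk]
  rfl

/-- **`x_j` is merged** iff `A₁`, `A₂` are blue or `A₃`, `A₄` are. -/
theorem Mg_cyc3_exit₂ (hij : i.val ≤ j.val) (hjk : j.val ≤ k.val) :
    (cyc n).Mg 0 j ω ↔ (allc n (arc₁ n i) false ω ∧ allc n (arc₂ n i j) false ω) ∨
      (allc n (arc₃' n j k) false ω ∧ allc n (arc₄ n k) false ω) := by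
  unfold Mg
  rw [← Pendant.cAdj_false, mem_reach_cyc_zero, allc_lt_iff₂ n i j false ω hij, allc_ge_iff₄ n j k false ω hjk]

/-- **`x_j` is reached** iff `A₁`, `A₂` are red or `A₃`, `A₄` are. -/
theorem Rd_cyc3_exit₂ (hij : i.val ≤ j.val) (hjk : j.val ≤ k.val) :
    (cyc n).Rd 0 j ω ↔ (allc n (arc₁ n i) true ω ∧ allc n (arc₂ n i j) true ω) ∨
      (allc n (arc₃' n j k) true ω ∧ allc n (arc₄ n k) true ω) := by
  unfold Rd
  rw [← Pendant.cAdj_true, mem_reach_cyc_zero, allc_lt_iff₂ n i j true ω hij, allc_ge_iff₄ n j k true ω hjk]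

/-- **`x_k` is merged** iff `A₄` is blue or `A₁`, `A₂`, `A₃` are. -/
theorem Mg_cyc3_exit₃ (hij : i.val ≤ j.val) (hjk : j.val ≤ k.val) :
    (cyc n).Mg 0 k ω ↔ allc n (arc₄ n k) false ω ∨
      (allc n (arc₁ n i) false ω ∧ allc n (arc₂ n i j) false ω ∧ allc n (arc₃' n j k) false ω) := by
  unfold Mg
  rw [← Pendant.cAdj_false, mem_reach_cyc_zero, allc_lt_iff₃ n i j k false ω hij hjk, or_comm]
  rfl

/-- **`x_k` is reached** iff `A₄` is red or `A₁`, `A₂`, `A₃` are. -/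
theorem Rd_cyc3_exit₃ (hij : i.val ≤ j.val) (hjk : j.val ≤ k.val) :
    (cyc n).Rd 0 k ω ↔ allc n (arc₄ n k) true ω ∨
      (allc n (arc₁ n i) true ω ∧ allc n (arc₂ n i j) true ω ∧ allc n (arc₃' n j k) true ω) := by
  unfold Rd
  rw [← Pendant.cAdj_true, mem_reach_cyc_zero, allc_lt_iff₃ n i j k true ω hij hjk, or_comm]
  rfl

/-- **`x_i`, `x_j` are blue-connected** iff `A₂` is blue or `A₁`, `A₃`, `A₄` are. -/
theorem Mg_cyc3_exits₁₂ (hij : i.val ≤ j.val) (hjk : j.val ≤ k.val) :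
    (cyc n).Mg i j ω ↔ allc n (arc₂ n i j) false ω ∨
      (allc n (arc₁ n i) false ω ∧ allc n (arc₃' n j k) false ω ∧ allc n (arc₄ n k) false ω) := by
  unfold Mg
  rw [← Pendant.cAdj_false, mem_reach_cyc_le n false ω i j hij, ← allc_outer_iff₂ n i j k false ω hjk]
  rfl

/-- **`x_j`, `x_k` are blue-connected** iff `A₃` is blue or `A₁`, `A₂`, `A₄` are. -/
theorem Mg_cyc3_exits₂₃ (hij : i.val ≤ j.val) (hjk : j.val ≤ k.val) :
    (cyc n).Mg j k ω ↔ allc n (arc₃' n j k) false ω ∨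
      (allc n (arc₁ n i) false ω ∧ allc n (arc₂ n i j) false ω ∧ allc n (arc₄ n k) false ω) := by
  unfold Mg
  rw [← Pendant.cAdj_false, mem_reach_cyc_le n false ω j k hjk, ← allc_outer_iff₃ n i j k false ω hij]
  rfl

/-- **`x_i`, `x_k` are blue-connected** iff `A₂`, `A₃` are blue or `A₁`, `A₄` are. -/
theorem Mg_cyc3_exits₁₃ (hij : i.val ≤ j.val) (hjk : j.val ≤ k.val) :
    (cyc n).Mg i k ω ↔ (allc n (arc₂ n i j) false ω ∧ allc n (arc₃' n j k) false ω) ∨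
      (allc n (arc₁ n i) false ω ∧ allc n (arc₄ n k) false ω) := by
  unfold Mg
  rw [← Pendant.cAdj_false, mem_reach_cyc_le n false ω i k (hij.trans hjk), ← allc_outer_iff₁₃ n i k false ω,
    ← allc_mid_iff n i j k false ω hij hjk]

end TwoExit

end ZoneZ

end PercRepro
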